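import Summits.MatrixMultiplication.MatrixMultiplication.Theorems.ShapeSubmodularityPerfectAmortisation
import Literature.Computability.AlgebraicComplexity.BigCwFourthOmega
import Literature.Computability.AlgebraicComplexity.RectangularExponentLaserCertificate
import Literature.Computability.AlgebraicComplexity.RectangularExponentAsymptoticRank
import Literature.Computability.AlgebraicComplexity.LaserMethodTypeCount
import Literature.Computability.AlgebraicComplexity.LaserMethodBigCW
import Literature.Computability.AlgebraicComplexity.SchonhageRectangular
import Literature.Computability.AlgebraicComplexity.MaxEntropyGivenMarginals
import Literature.Computability.AlgebraicComplexity.CoppersmithWinograd1990Proofs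
import Literature.Computability.AlgebraicComplexity.RectangularExponentBounds
import HarnessLib

/-!
# OctaveBudgetFivePatternDiagonal — the FULL first power of `CW_q` (scalar blocks included), part 1:
the symmetric five-pattern joint type, its free diagonal and its entropy side
(decomp-mm cell, lens 5 «finite/base range + asymptotic regime + bridge», generation 11; part 2 of 4 of the
kernel-rungs file of generations 4–10; support machinery for items `stmt-MatrixMultiplication-26290`,
`26291`, `25359` of `route-MatrixMultiplication-OctaveBudget`, closed in `OctaveBudgetFivePatternCerts.lean`)

The symmetric five-pattern joint type `(a·m, a·m, b·m ; c·m, 0, c·m)` on the support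
`(1,1,0), (0,1,1), (1,0,1) ; (2,0,0), (0,2,0), (0,0,2)` of the Coppersmith–Winograd tensor `CW_q`
(`n = 2a+b+2c`, `k·a ≤ b`) runs through the SAME tree theorems as the PerfectAmortisation pipeline of
`Theorems/ShapeSubmodularityPerfectAmortisation*.lean` (`exists_free_diagonal_jointType_card`, stub A
`PerfectAmortisation.stub_cwRectRestriction` — the scalar letters `(2,0,0), (0,0,2)` contribute trivial
`⟨1,1,1⟩` factors):

* §1 `fp_diagonalRaw` / `fp_diagonal`: a free diagonal of the type class of size
  `≥ (multinomial) · exp(−penalty)` with the penalty term ZERO, because EVERY law on `{i+j+l = 2}` is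
  determined by its three marginals (`eq_of_mem_sameMarginalsOn_fp`, `maxEntropyPenalty_fp_nonpos`);
* §2 `fp_entropy`: the min-entropy in closed form, `H_X = η((a+c)/n) + η((a+b)/n) + η(c/n)`,
  `H_Y = η((b+2c)/n) + η(2a/n)` (`η = Real.negMulLog`, nats).

The analytic threshold, the packing certificate `ω(1,1,k) ≤ n (log(q+2) − min(H_X,H_Y))/(a log q)` and the
two-inequality certificate checker are in `OctaveBudgetFivePattern.lean`; the certificates
`e(10) ≤ 1/7`, `e(15) ≤ 1/8`, `e(17) ≤ 1/9`, `e(19) ≤ 2/19`, `e(20) ≤ 1/10` and the rungs `K = 10 … 20` in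
`OctaveBudgetFivePatternCerts.lean`.

References: [cite: CoppersmithWinograd1990, §6–§7]; [cite: HuangPan1998, §8] (the rectangular first power);
[cite: BurgisserClausenShokrollahi1997, §15.7–§15.8] (type classes, free diagonals and `CW_q`, as formalised in the tree).
-/

set_option linter.dupNamespace false -- `MatrixMultiplication.MatrixMultiplication` (summit = problem, D-0017)

noncomputable section

namespace Summit.MatrixMultiplication.MatrixMultiplication.Theorems.OctaveBudgetFivePattern

open scoped BigOperators
open Finset
open Literature.Computability.AlgebraicComplexity
open Literature.Barriers.MatrixMultiplication
open Summit.MatrixMultiplication.MatrixMultiplication.Theorems.PerfectAmortisation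
  (stub_cwRectRestriction)

/-! ### §1  A large free diagonal of the five-pattern type (tree `exists_free_diagonal_jointType_card`) -/

/-- **Combinatorial layer for the five-pattern type.**  For `a, m ≥ 1`, `N = (2a+b+2c) m` and
`P = Q/N` with `Q(1,1,0) = Q(0,1,1) = a m`, `Q(1,0,1) = b m`, `Q(2,0,0) = Q(0,0,2) = c m` (`0`
elsewhere), there is a free diagonal `Δ` of level-word triples, coordinatewise in `cwSupport₃`, each with
exactly `a m`, `a m`, `b m` positions of pattern `(1,1,0)`, `(0,1,1)`, `(1,0,1)`, with
`2^{N (min_m H(P_m) − Γ_S(P))} ≤ |Δ| · (N+1)^63 · 192 · exp(4 √(log 6 + N log 27))`.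
[cite: LeGall2014, Appendix A.3] -/
theorem fp_diagonalRaw (a b c m : ℕ) (ha : 1 ≤ a) (hm : 1 ≤ m) (P : Fin 3 × Fin 3 × Fin 3 → ℝ)
    (hP : ∀ s, P s = ((if s = (1, 1, 0) then a * m else if s = (0, 1, 1) then a * m
        else if s = (1, 0, 1) then b * m else if s = (2, 0, 0) then c * m
        else if s = (0, 0, 2) then c * m else 0 : ℕ) : ℝ) / ((((2 * a + b + 2 * c) * m : ℕ) : ℝ))) :
    ∃ Δ : Finset ((Fin ((2 * a + b + 2 * c) * m) → Fin 3) × (Fin ((2 * a + b + 2 * c) * m) → Fin 3) ×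
        (Fin ((2 * a + b + 2 * c) * m) → Fin 3)),
      (∀ δ ∈ Δ, ∀ ρ, labelSeq δ ρ ∈ cwSupport₃) ∧
      (∀ δ ∈ Δ, letterCount (labelSeq δ) (1, 1, 0) = a * m ∧
        letterCount (labelSeq δ) (0, 1, 1) = a * m ∧ letterCount (labelSeq δ) (1, 0, 1) = b * m) ∧
      (∀ δ ∈ Δ, ∀ δ' ∈ Δ, ∀ δ'' ∈ Δ, (∀ ρ, (δ.1 ρ, δ'.2.1 ρ, δ''.2.2 ρ) ∈ cwSupport₃) →
        δ = δ' ∧ δ' = δ'') ∧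
      (2 : ℝ) ^ (((((2 * a + b + 2 * c) * m : ℕ) : ℝ)) *
          (min (shannonEntropy (marginalDist₁ P))
            (min (shannonEntropy (marginalDist₂ P)) (shannonEntropy (marginalDist₃ P))) -
            maxEntropyPenalty cwSupport₃ P)) ≤
        (Δ.card : ℝ) * (((((2 * a + b + 2 * c) * m : ℕ) : ℝ)) + 1) ^ 63 * 192 *
          Real.exp (4 * Real.sqrt (Real.log 6 + ((((2 * a + b + 2 * c) * m : ℕ) : ℝ)) * Real.log 27)) := by
  classical
  have hinj : Function.Injective fun (i : Fin 3) (_ : Fin 1) => (i : ℤ) := by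
    intro i i' h
    have h0 := congrFun h 0
    simp only [Nat.cast_inj] at h0
    exact Fin.ext h0
  have hinjγ : Function.Injective fun (l : Fin 3) (_ : Fin 1) => (l : ℤ) - 2 := by
    intro l l' h
    have h0 := congrFun h 0
    simp only [sub_left_inj, Nat.cast_inj] at h0
    exact Fin.ext h0
  have hbd : ∀ (i : Fin 3) (ρ : Fin 1), |((fun (i : Fin 3) (_ : Fin 1) => (i : ℤ)) i ρ)| ≤ (2 : ℕ) := by
    intro i ρ
    have := i.isLt
    simp only [Nat.cast_ofNat, Nat.abs_cast]
    omega
  have htight : ∀ s ∈ cwSupport₃, ∀ ρ : Fin 1,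
      (fun (i : Fin 3) (_ : Fin 1) => (i : ℤ)) s.1 ρ + (fun (j : Fin 3) (_ : Fin 1) => (j : ℤ)) s.2.1 ρ +
        (fun (l : Fin 3) (_ : Fin 1) => (l : ℤ) - 2) s.2.2 ρ = 0 := by
    intro s hs ρ
    rw [mem_cwSupport₃] at hs
    simp only
    omega
  obtain ⟨Q, hQdef⟩ : ∃ Q : Fin 3 × Fin 3 × Fin 3 → ℕ, Q = fun s =>
      if s = (1, 1, 0) then a * m else if s = (0, 1, 1) then a * m
        else if s = (1, 0, 1) then b * m else if s = (2, 0, 0) then c * m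
        else if s = (0, 0, 2) then c * m else 0 := ⟨_, rfl⟩
  have hN : 0 < (2 * a + b + 2 * c) * m := Nat.mul_pos (by omega) (by omega)
  have hQS : ∀ s, s ∉ cwSupport₃ → Q s = 0 := by
    intro s hs
    rw [mem_cwSupport₃_iff] at hs
    push Not at hs
    obtain ⟨h1, h2, h3, h4, -, h6⟩ := hs
    simp [hQdef, h1, h2, h3, h4, h6]
  have hQ : ∑ s, Q s = (2 * a + b + 2 * c) * m := by
    rw [sum_triple_eq, hQdef]
    simp [Fin.sum_univ_three]
    ring
  have hP' : ∀ s, P s = (Q s : ℝ) / ((((2 * a + b + 2 * c) * m : ℕ) : ℝ)) := by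
    intro s
    rw [hQdef]
    exact hP s
  obtain ⟨Δ, hΔQ, hfree, hsize⟩ := exists_free_diagonal_jointType_card cwSupport₃ (r := 1) (b := 2)
    (fun (i : Fin 3) (_ : Fin 1) => (i : ℤ)) (fun (j : Fin 3) (_ : Fin 1) => (j : ℤ))
    (fun (l : Fin 3) (_ : Fin 1) => (l : ℤ) - 2) hinj hinj hinjγ hbd hbd htight hN Q hQS hQ P hP'
  have hQδ : ∀ δ ∈ Δ, letterCount (labelSeq δ) = Q := fun δ hδ => (Finset.mem_filter.1 (hΔQ hδ)).2
  refine ⟨Δ, ?_, ?_, hfree, ?_⟩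
  · intro δ hδ ρ
    by_contra hρ
    have h0 := hQS _ hρ
    rw [← hQδ δ hδ] at h0
    exact (letterCount_pos_of_apply (labelSeq δ) ρ).ne' h0
  · intro δ hδ
    rw [hQδ δ hδ, hQdef]
    simp
  · refine hsize.trans_eq ?_
    have hmax : (max 2 1 : ℕ) = 2 := by decide
    generalize ((((2 * a + b + 2 * c) * m : ℕ) : ℝ)) = Nr
    simp only [Fintype.card_prod, Fintype.card_fin, hmax]
    norm_num
    simp only [mul_assoc]

/-! ### §2  Entropy side: marginals, `Γ = 0`, and the min-entropy in closed form -/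

/-- `H(p₀, p₁, p₂) = (η(p₀) + η(p₁) + η(p₂)) / log 2` with `η = negMulLog` (bits). [folklore] -/
theorem shannonEntropy_vec3 (p₀ p₁ p₂ : ℝ) :
    shannonEntropy ![p₀, p₁, p₂] =
      (Real.negMulLog p₀ + Real.negMulLog p₁ + Real.negMulLog p₂) / Real.log 2 := by
  rw [shannonEntropy_def, Fin.sum_univ_three]
  simp

/-- The three marginals of the five-pattern law (`α` on `(1,1,0)`, `(0,1,1)`; `β` on `(1,0,1)`;
`γ` on `(2,0,0)`, `(0,0,2)`): `X = Z = (α+γ, α+β, γ)`, `Y = (β+2γ, 2α, 0)`. [folklore] -/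
theorem marginalDist_fp {α β γ : ℝ} {P : Fin 3 × Fin 3 × Fin 3 → ℝ}
    (hP : ∀ s, P s = if s = (1, 1, 0) then α else if s = (0, 1, 1) then α
      else if s = (1, 0, 1) then β else if s = (2, 0, 0) then γ else if s = (0, 0, 2) then γ else 0) :
    marginalDist₁ P = ![α + γ, α + β, γ] ∧ marginalDist₂ P = ![β + 2 * γ, 2 * α, 0] ∧
      marginalDist₃ P = ![α + γ, α + β, γ] := by
  refine ⟨?_, ?_, ?_⟩ <;> funext i <;> fin_cases i <;>
    simp [marginalDist₁, marginalDist₂, marginalDist₃, Fin.sum_univ_three, hP] <;> ring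

/-- The five-pattern law vanishes off `{i + j + l = 2}`. [folklore] -/
theorem fp_eq_zero_of_not_mem {α β γ : ℝ} {P : Fin 3 × Fin 3 × Fin 3 → ℝ}
    (hP : ∀ s, P s = if s = (1, 1, 0) then α else if s = (0, 1, 1) then α
      else if s = (1, 0, 1) then β else if s = (2, 0, 0) then γ else if s = (0, 0, 2) then γ else 0)
    {s : Fin 3 × Fin 3 × Fin 3} (hs : s ∉ cwSupport₃) : P s = 0 := by
  rw [mem_cwSupport₃_iff] at hs
  push Not at hs
  rw [hP]
  simp [hs.1, hs.2.1, hs.2.2.1, hs.2.2.2.1, hs.2.2.2.2.2]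

/-- **`D(P) = {P}` on `{i+j+l = 2}`**: a law on the support of `CW_q` with the marginals of the
five-pattern law coincides with it — the level-`2` marginals give the three corner points, and each
matrix pattern is then read off from one level-`0` marginal. [folklore] -/
theorem eq_of_mem_sameMarginalsOn_fp {α β γ : ℝ} {P P' : Fin 3 × Fin 3 × Fin 3 → ℝ}
    (hP : ∀ s, P s = if s = (1, 1, 0) then α else if s = (0, 1, 1) then α
      else if s = (1, 0, 1) then β else if s = (2, 0, 0) then γ else if s = (0, 0, 2) then γ else 0)
    (hP' : P' ∈ sameMarginalsOn cwSupport₃ P) : P' = P := by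
  obtain ⟨-, hoff, h₁, h₂, h₃⟩ := hP'
  obtain ⟨hm₁, hm₂, hm₃⟩ := marginalDist_fp hP
  have z : ∀ i j l : Fin 3, (i : ℕ) + j + l ≠ 2 → P' (i, j, l) = 0 := fun i j l h =>
    hoff _ (mt mem_cwSupport₃.1 h)
  have e₁ : marginalDist₁ P' 2 = γ := by rw [h₁, hm₁]; simp
  have e₂ : marginalDist₂ P' 2 = 0 := by rw [h₂, hm₂]; simp
  have e₃ : marginalDist₃ P' 2 = γ := by rw [h₃, hm₃]; simp
  have f₁ : marginalDist₁ P' 0 = α + γ := by rw [h₁, hm₁]; simp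
  have f₂ : marginalDist₂ P' 0 = β + 2 * γ := by rw [h₂, hm₂]; simp
  have f₃ : marginalDist₃ P' 0 = α + γ := by rw [h₃, hm₃]; simp
  simp (disch := decide) only [marginalDist₁, marginalDist₂, marginalDist₃, Fin.sum_univ_three, z,
    add_zero, zero_add] at e₁ e₂ e₃ f₁ f₂ f₃
  have p011 : P' (0, 1, 1) = α := by linarith
  have p101 : P' (1, 0, 1) = β := by linarith
  have p110 : P' (1, 1, 0) = α := by linarith
  funext s
  by_cases hs : s ∈ cwSupport₃
  · rw [hP]
    rw [mem_cwSupport₃_iff] at hs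
    rcases hs with rfl | rfl | rfl | rfl | rfl | rfl <;> simp [p011, p101, p110, e₁, e₂, e₃]
  · rw [hoff s hs, fp_eq_zero_of_not_mem hP hs]

/-- **The penalty vanishes** for the five-pattern law (`α, β, γ ≥ 0`, `2α + β + 2γ = 1`). [folklore] -/
theorem maxEntropyPenalty_fp_nonpos {α β γ : ℝ} {P : Fin 3 × Fin 3 × Fin 3 → ℝ}
    (hP : ∀ s, P s = if s = (1, 1, 0) then α else if s = (0, 1, 1) then α
      else if s = (1, 0, 1) then β else if s = (2, 0, 0) then γ else if s = (0, 0, 2) then γ else 0)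
    (hα : 0 ≤ α) (hβ : 0 ≤ β) (hγ : 0 ≤ γ) (hsum : 2 * α + β + 2 * γ = 1) :
    maxEntropyPenalty cwSupport₃ P ≤ 0 := by
  have hsimplex : P ∈ stdSimplex ℝ (Fin 3 × Fin 3 × Fin 3) := by
    refine ⟨fun s => ?_, ?_⟩
    · rw [hP]
      split_ifs <;> linarith
    · rw [sum_triple_eq]
      simp [Fin.sum_univ_three, hP]
      linarith
  have hsupp : ∀ x, x ∉ cwSupport₃ → P x = 0 := fun x hx => fp_eq_zero_of_not_mem hP hx
  have hle : maxEntropyGivenMarginals cwSupport₃ P ≤ shannonEntropy P :=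
    maxEntropyGivenMarginals_le ⟨P, self_mem_sameMarginalsOn hsimplex hsupp⟩
      fun P' hP' => (congrArg shannonEntropy (eq_of_mem_sameMarginalsOn_fp hP hP')).le
  exact sub_nonpos.2 hle

/-- **Entropy evaluation of the five-pattern type** `P = Q/N`: with `n = 2a+b+2c`,
`log 2 · (min_m H(P_m) − Γ_S(P)) ≥ min (H_X, H_Y)` where (nats)
`H_X = η((a+c)/n) + η((a+b)/n) + η(c/n)` and `H_Y = η((b+2c)/n) + η(2a/n)`. [folklore] -/
theorem fp_entropy (a b c m : ℕ) (ha : 1 ≤ a) (hm : 1 ≤ m) (P : Fin 3 × Fin 3 × Fin 3 → ℝ)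
    (hP : ∀ s, P s = ((if s = (1, 1, 0) then a * m else if s = (0, 1, 1) then a * m
        else if s = (1, 0, 1) then b * m else if s = (2, 0, 0) then c * m
        else if s = (0, 0, 2) then c * m else 0 : ℕ) : ℝ) / ((((2 * a + b + 2 * c) * m : ℕ) : ℝ))) :
    min (Real.negMulLog (((a : ℝ) + c) / ((2 * a + b + 2 * c : ℕ) : ℝ)) +
          Real.negMulLog (((a : ℝ) + b) / ((2 * a + b + 2 * c : ℕ) : ℝ)) +
          Real.negMulLog ((c : ℝ) / ((2 * a + b + 2 * c : ℕ) : ℝ)))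
        (Real.negMulLog (((b : ℝ) + 2 * c) / ((2 * a + b + 2 * c : ℕ) : ℝ)) +
          Real.negMulLog (2 * (a : ℝ) / ((2 * a + b + 2 * c : ℕ) : ℝ))) ≤
      Real.log 2 * (min (shannonEntropy (marginalDist₁ P))
        (min (shannonEntropy (marginalDist₂ P)) (shannonEntropy (marginalDist₃ P))) -
        maxEntropyPenalty cwSupport₃ P) := by
  set n : ℝ := ((2 * a + b + 2 * c : ℕ) : ℝ) with hn
  have hn0 : (0 : ℝ) < n := by rw [hn]; exact_mod_cast (by omega : 0 < 2 * a + b + 2 * c)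
  have hn0' : n ≠ 0 := hn0.ne'
  have hm0 : (0 : ℝ) < m := by exact_mod_cast (by omega : 0 < m)
  have hm0' : (m : ℝ) ≠ 0 := hm0.ne'
  have hncast : n = 2 * (a : ℝ) + b + 2 * c := by rw [hn]; push_cast; ring
  -- the law with real weights `α = a/n`, `β = b/n`, `γ = c/n`
  have hPr : ∀ s, P s = if s = (1, 1, 0) then (a : ℝ) / n else if s = (0, 1, 1) then (a : ℝ) / n
      else if s = (1, 0, 1) then (b : ℝ) / n else if s = (2, 0, 0) then (c : ℝ) / n
      else if s = (0, 0, 2) then (c : ℝ) / n else 0 := by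
    intro s
    rw [hP s]
    have hN : ((((2 * a + b + 2 * c) * m : ℕ) : ℝ)) = n * m := by rw [hn]; push_cast; ring
    rw [hN]
    split_ifs <;> push_cast
    · rw [mul_div_mul_right _ _ hm0']
    · rw [mul_div_mul_right _ _ hm0']
    · rw [mul_div_mul_right _ _ hm0']
    · rw [mul_div_mul_right _ _ hm0']
    · rw [mul_div_mul_right _ _ hm0']
    · simp
  obtain ⟨hm₁, hm₂, hm₃⟩ := marginalDist_fp hPr
  have hpen : maxEntropyPenalty cwSupport₃ P ≤ 0 :=
    maxEntropyPenalty_fp_nonpos hPr (by positivity) (by positivity) (by positivity)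
      (by field_simp; linarith [hncast])
  have hlog : 0 < Real.log 2 := Real.log_pos one_lt_two
  have e1 : (a : ℝ) / n + c / n = ((a : ℝ) + c) / n := by ring
  have e2 : (a : ℝ) / n + b / n = ((a : ℝ) + b) / n := by ring
  have e3 : (b : ℝ) / n + 2 * ((c : ℝ) / n) = ((b : ℝ) + 2 * c) / n := by ring
  have e4 : 2 * ((a : ℝ) / n) = 2 * (a : ℝ) / n := by ring
  rw [hm₁, hm₂, hm₃, e1, e2, e3, e4, shannonEntropy_vec3, shannonEntropy_vec3, Real.negMulLog_zero,
    add_zero]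
  set HX : ℝ := Real.negMulLog (((a : ℝ) + c) / n) + Real.negMulLog (((a : ℝ) + b) / n) +
    Real.negMulLog ((c : ℝ) / n) with hHX
  set HY : ℝ := Real.negMulLog (((b : ℝ) + 2 * c) / n) + Real.negMulLog (2 * (a : ℝ) / n) with hHY
  have key : Real.log 2 * min (HX / Real.log 2) (min (HY / Real.log 2) (HX / Real.log 2)) =
      min HX HY := by
    rw [min_div_div_right hlog.le, min_div_div_right hlog.le, mul_div_cancel₀ _ hlog.ne',
      min_comm HY HX, ← min_assoc, min_self]
  have h2 : Real.log 2 * maxEntropyPenalty cwSupport₃ P ≤ 0 :=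
    mul_nonpos_of_nonneg_of_nonpos hlog.le hpen
  rw [mul_sub, key]
  linarith

/-- §1 + §2: the free diagonal of the five-pattern type with the size bound in closed form
`exp(N · min(H_X, H_Y)) ≤ |Δ| · (N+1)^63 · 192 · exp(4 √(log 6 + N log 27))`. -/
theorem fp_diagonal (a b c m : ℕ) (ha : 1 ≤ a) (hm : 1 ≤ m) :
    ∃ Δ : Finset ((Fin ((2 * a + b + 2 * c) * m) → Fin 3) × (Fin ((2 * a + b + 2 * c) * m) → Fin 3) ×
        (Fin ((2 * a + b + 2 * c) * m) → Fin 3)),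
      (∀ δ ∈ Δ, ∀ ρ, labelSeq δ ρ ∈ cwSupport₃) ∧
      (∀ δ ∈ Δ, letterCount (labelSeq δ) (1, 1, 0) = a * m ∧
        letterCount (labelSeq δ) (0, 1, 1) = a * m ∧ letterCount (labelSeq δ) (1, 0, 1) = b * m) ∧
      (∀ δ ∈ Δ, ∀ δ' ∈ Δ, ∀ δ'' ∈ Δ, (∀ ρ, (δ.1 ρ, δ'.2.1 ρ, δ''.2.2 ρ) ∈ cwSupport₃) →
        δ = δ' ∧ δ' = δ'') ∧
      Real.exp (((((2 * a + b + 2 * c) * m : ℕ) : ℝ)) *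
          min (Real.negMulLog (((a : ℝ) + c) / ((2 * a + b + 2 * c : ℕ) : ℝ)) +
                Real.negMulLog (((a : ℝ) + b) / ((2 * a + b + 2 * c : ℕ) : ℝ)) +
                Real.negMulLog ((c : ℝ) / ((2 * a + b + 2 * c : ℕ) : ℝ)))
              (Real.negMulLog (((b : ℝ) + 2 * c) / ((2 * a + b + 2 * c : ℕ) : ℝ)) +
                Real.negMulLog (2 * (a : ℝ) / ((2 * a + b + 2 * c : ℕ) : ℝ)))) ≤
        (Δ.card : ℝ) * (((((2 * a + b + 2 * c) * m : ℕ) : ℝ)) + 1) ^ 63 * 192 *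
          Real.exp (4 * Real.sqrt (Real.log 6 + ((((2 * a + b + 2 * c) * m : ℕ) : ℝ)) * Real.log 27)) := by
  set P : Fin 3 × Fin 3 × Fin 3 → ℝ := fun s =>
    ((if s = (1, 1, 0) then a * m else if s = (0, 1, 1) then a * m
        else if s = (1, 0, 1) then b * m else if s = (2, 0, 0) then c * m
        else if s = (0, 0, 2) then c * m else 0 : ℕ) : ℝ) / ((((2 * a + b + 2 * c) * m : ℕ) : ℝ)) with hP
  have hPs : ∀ s, P s = ((if s = (1, 1, 0) then a * m else if s = (0, 1, 1) then a * m
        else if s = (1, 0, 1) then b * m else if s = (2, 0, 0) then c * m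
        else if s = (0, 0, 2) then c * m else 0 : ℕ) : ℝ) / ((((2 * a + b + 2 * c) * m : ℕ) : ℝ)) :=
    fun s => rfl
  obtain ⟨Δ, hS, hcnt, hfree, hsize⟩ := fp_diagonalRaw a b c m ha hm P hPs
  have hent := fp_entropy a b c m ha hm P hPs
  refine ⟨Δ, hS, hcnt, hfree, le_trans ?_ hsize⟩
  set X : ℝ := min (shannonEntropy (marginalDist₁ P))
      (min (shannonEntropy (marginalDist₂ P)) (shannonEntropy (marginalDist₃ P))) -
      maxEntropyPenalty cwSupport₃ P with hX
  have hN0 : (0 : ℝ) ≤ ((((2 * a + b + 2 * c) * m : ℕ) : ℝ)) := Nat.cast_nonneg _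
  rw [Real.rpow_def_of_pos two_pos, Real.exp_le_exp]
  calc ((((2 * a + b + 2 * c) * m : ℕ) : ℝ)) * _
      ≤ ((((2 * a + b + 2 * c) * m : ℕ) : ℝ)) * (Real.log 2 * X) := mul_le_mul_of_nonneg_left hent hN0
    _ = Real.log 2 * (((((2 * a + b + 2 * c) * m : ℕ) : ℝ)) * X) := by ring

end Summit.MatrixMultiplication.MatrixMultiplication.Theorems.OctaveBudgetFivePattern

end
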